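import Summits.CriticalPhenomena.PercolationContinuityZ3.Theorems.SubpolynomialBlocking.Negative.Strengthenings
import Literature.Probability.Percolation.ThinAnnulus
import Literature.Probability.Percolation.KestenTheoremProofs
import HarnessLib

/-!
# Crux `PercNonProliferation.SubpolynomialBlocking` (stmt-CriticalPhenomena-4446), line `root-trick-wall-patch` — stub `stub_blockProb_two_pos`

Helper file for the lead's skeleton of the line `root-trick-wall-patch` of the crux
`Summit.CriticalPhenomena.PercolationContinuityZ3.Theses.PercNonProliferation.SubpolynomialBlocking`.
Proves exactly the registered stub signature `stub_blockProb_two_pos` (the `d = 2` CALIBRATION of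
the crux); lands with `--supports stmt-CriticalPhenomena-4446`.

## The statement

`∃ c > 0, ∀ n ≥ 1, c ≤ u_n(2, p_c(ℤ²))`, where `u_n(d, p) = Negative.blockProb d p n =
P_p(Λ_n ↮ ∂ⁱⁿΛ_{2n} in Λ_{2n})` is the annulus-blocking probability of the crux (the crux is
`∀ s > 0, ∀ᶠ n, n^{-s} ≤ u_n(3, p_c(ℤ³))`, open in `d = 3`). As a corollary the crux's statement
with `d = 3` replaced by `d = 2` holds (`subpolynomialBlockingAt_two`).

## The argument (Russo–Seymour–Welsh at `p_c(ℤ²) = 1/2`, rectangle duality, Harris)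

* `p_c(ℤ²) = 1/2` (Kesten, `kesten_criticalProb_Z2_holds`), so `criticalProbI 2 = half`.
* Deterministic step (`StubBlockProbTwoPos.not_mem_annulusCrossing_of_thinAnnulusBlocked`): on a
  lattice configuration in the tree's blocked thin square annulus `thinAnnulusBlocked n n`
  (`ThinAnnulus.lean`: none of the four `4n × n` rectangles of `{n ≤ ‖z‖_∞ ≤ 2n}` is crossed the
  short way by an open path) every open path from `Λ_n` stays in the OPEN box `(-2n, 2n)²`
  (`openConnIn_box_of_thinAnnulusBlocked`), whereas a site of `∂ⁱⁿΛ_{2n}` has a coordinate `± 2n`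
  (`exists_eq_of_mem_innerBoundary_box`); hence `thinAnnulusBlocked n n ⊆ (annulusCrossing 2 n)ᶜ`
  up to the null set of non-lattice configurations (`DCT16.real_mono_of_forall_subset_edgeSet`).
* Probability (`StubBlockProbTwoPos.exists_pos_le_one_sub_crossingProb`): by Harris's lemma
  `P_p(thinAnnulusBlocked n n) ≥ (1 - crossingProb p n (4n))⁴`
  (`pow_four_le_real_thinAnnulusBlocked`); by duality of crossing probabilities
  (`crossingProb_add_crossingProb_symm_holds`, Bollobás–Riordan 2006, Ch. 3, Cor. 3(i), and
  `σ(1/2) = 1/2`) `1 - crossingProb ½ n (4n) = crossingProb ½ (4n+1) (n-1)`, which is at least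
  `crossingProb ½ (6n-1) (n-1) ≥ c₆ > 0` (antitonicity in the width, `crossingProb_anti_left`,
  `4n + 1 ≤ 6n - 1` for `n ≥ 1`; RSW lower bound at aspect ratio `6`, `rsw_lowerBound_holds`).
  So `u_n(2, 1/2) ≥ c₆⁴` for every `n ≥ 1`.

No new definitions; the blocking event is the registered `Negative.blockProb`.
-/

noncomputable section

namespace Summit.CriticalPhenomena.PercolationContinuityZ3.Theorems.SubpolynomialBlocking

open MeasureTheory Filter Topology
open Literature.Probability.Percolation Literature.Probability.LatticeModels
open Summit.CriticalPhenomena.PercolationContinuityZ3.Theorems.SubpolynomialBlocking.Negative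

namespace StubBlockProbTwoPos

/-- **Kesten's theorem in `unitInterval` form**: `p_c(ℤ²) = 1/2` as points of `[0, 1]`
(`kesten_criticalProb_Z2_holds`; `(criticalProbI 2 : ℝ) = criticalProb (zdGraph 2) 0` is `rfl`). -/
theorem criticalProbI_two_eq_half : criticalProbI 2 = half := by
  have hK : criticalProb (zdGraph 2) 0 = 1 / 2 := kesten_criticalProb_Z2_holds
  exact Subtype.ext (by simp [criticalProbI, half, hK])

/-- **Deterministic core.** On a lattice configuration `ω ⊆ E(ℤ²)` in the blocked thin annulus
`thinAnnulusBlocked n n` (`n ≥ 1`), there is no open path inside `Λ_{2n}` from `Λ_n` to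
`∂ⁱⁿΛ_{2n}`: open paths from `Λ_n` stay in the open box `(-2n, 2n)²`
(`openConnIn_box_of_thinAnnulusBlocked`), and every site of `∂ⁱⁿΛ_{2n}` has a coordinate `± 2n`. -/
theorem not_mem_annulusCrossing_of_thinAnnulusBlocked {n : ℕ} (hn : 1 ≤ n)
    {ω : BondConfig (Site 2)} (hω : ω ⊆ (zdGraph 2).edgeSet) (hB : ω ∈ thinAnnulusBlocked n n) :
    ω ∉ Literature.Barriers.CriticalPhenomena.annulusCrossing 2 n := by
  rintro ⟨x, hx, y, hy, hxy⟩
  have h := openConnIn_box_of_thinAnnulusBlocked hω hn hB hx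
    (openConnIn_mono (Set.subset_univ _) x y hxy)
  obtain ⟨i, hi | hi⟩ := exists_eq_of_mem_innerBoundary_box hy
  · have := (h i).2
    push_cast at this hi
    omega
  · have := (h i).1
    push_cast at this hi
    omega

/-- **RSW numerics at `p = 1/2`.** There is `c > 0` with `c ≤ 1 - crossingProb ½ n (2(n+n))`
for all `n ≥ 1`: by duality `1 - crossingProb ½ n (4n) = crossingProb ½ (4n+1) (n-1)`
(`crossingProb_add_crossingProb_symm_holds`, `symm_half`), and
`crossingProb ½ (4n+1) (n-1) ≥ crossingProb ½ (6n-1) (n-1) ≥ c₆` (`crossingProb_anti_left`,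
`rsw_lowerBound_holds` with `k = 6`). -/
theorem exists_pos_le_one_sub_crossingProb :
    ∃ c : ℝ, 0 < c ∧ ∀ n : ℕ, 1 ≤ n → c ≤ 1 - crossingProb half n (2 * (n + n)) := by
  obtain ⟨c, hc, hcn⟩ := rsw_lowerBound_holds 6 (by norm_num)
  refine ⟨c, hc, fun n hn => ?_⟩
  have hdual := crossingProb_add_crossingProb_symm_holds half (n - 1) (2 * (n + n))
  rw [symm_half, Nat.sub_add_cancel hn] at hdual
  have h' : 1 - crossingProb half n (2 * (n + n)) = crossingProb half (2 * (n + n) + 1) (n - 1) := by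
    linarith
  rw [h']
  exact (hcn n hn).trans (crossingProb_anti_left half (by omega : 2 * (n + n) + 1 ≤ 6 * n - 1) _)

/-- **The bound at `p = 1/2`.** There is `c > 0` with `c ≤ u_n(2, 1/2)` for all `n ≥ 1`:
`c₆⁴ ≤ (1 - crossingProb ½ n (4n))⁴ ≤ P_{1/2}(thinAnnulusBlocked n n) ≤ u_n(2, 1/2)`
(`exists_pos_le_one_sub_crossingProb`, Harris `pow_four_le_real_thinAnnulusBlocked`, and the
deterministic inclusion `not_mem_annulusCrossing_of_thinAnnulusBlocked` on lattice configurations,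
`DCT16.real_mono_of_forall_subset_edgeSet`). -/
theorem exists_pos_le_blockProb_half :
    ∃ c : ℝ, 0 < c ∧ ∀ n : ℕ, 1 ≤ n → c ≤ blockProb 2 half n := by
  obtain ⟨c, hc, hcn⟩ := exists_pos_le_one_sub_crossingProb
  refine ⟨c ^ 4, by positivity, fun n hn => ?_⟩
  calc c ^ 4 ≤ (1 - crossingProb half n (2 * (n + n))) ^ 4 := pow_le_pow_left₀ hc.le (hcn n hn) 4
    _ ≤ (bondPercolation (zdGraph 2) half).real (thinAnnulusBlocked n n) :=
        pow_four_le_real_thinAnnulusBlocked half n n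
    _ ≤ blockProb 2 half n :=
        DCT16.real_mono_of_forall_subset_edgeSet (zdGraph 2) half fun ω hω hB =>
          not_mem_annulusCrossing_of_thinAnnulusBlocked hn hω hB

end StubBlockProbTwoPos

/-- **Registered stub `stub_blockProb_two_pos`** (line `root-trick-wall-patch`, crux
`SubpolynomialBlocking`; the `d = 2` CALIBRATION of the crux): at `p_c(ℤ²) = 1/2` (Kesten) the
square annulus `Λ_{2n} ∖ Λ_n` of `ℤ²` is blocked — no open path inside `Λ_{2n}` joins `Λ_n` to
`∂ⁱⁿΛ_{2n}` — with probability at least `c > 0` uniformly in `n ≥ 1`. Proof: Russo–Seymour–Welsh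
at aspect ratio `6` (`rsw_lowerBound_holds`), duality of crossing probabilities
(`crossingProb_add_crossingProb_symm_holds`), Harris's lemma over the four rectangles of the thin
annulus `{n ≤ ‖z‖_∞ ≤ 2n}` (`pow_four_le_real_thinAnnulusBlocked`), and the deterministic
confinement of open paths by a blocked annulus (`StubBlockProbTwoPos.exists_pos_le_blockProb_half`). -/
theorem stub_blockProb_two_pos : ∃ c : ℝ, 0 < c ∧ ∀ n : ℕ, 1 ≤ n → c ≤ Negative.blockProb 2 (criticalProbI 2) n := by
  rw [StubBlockProbTwoPos.criticalProbI_two_eq_half]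
  exact StubBlockProbTwoPos.exists_pos_le_blockProb_half

/-- **The crux's statement holds in `d = 2`**: `SubpolynomialBlockingAt 2 p_c(ℤ²)`, i.e.
`∀ s > 0, ∀ᶠ n, n^{-s} ≤ u_n(2, p_c(ℤ²))` — eventually `n^{-s} < c ≤ u_n` by
`stub_blockProb_two_pos` and `n^{-s} → 0` (`tendsto_rpow_neg_atTop`). -/
theorem subpolynomialBlockingAt_two : SubpolynomialBlockingAt 2 (criticalProbI 2) := by
  rw [subpolynomialBlockingAt_iff]
  intro s hs
  obtain ⟨c, hc, hcn⟩ := stub_blockProb_two_pos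
  have hev : ∀ᶠ n : ℕ in atTop, (n : ℝ) ^ (-s) < c :=
    ((tendsto_rpow_neg_atTop hs).comp tendsto_natCast_atTop_atTop).eventually (gt_mem_nhds hc)
  filter_upwards [hev, eventually_ge_atTop 1] with n hn hn1
  exact hn.le.trans (hcn n hn1)

end Summit.CriticalPhenomena.PercolationContinuityZ3.Theorems.SubpolynomialBlocking

end
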